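import Summits.BirchSwinnertonDyer.BirchSwinnertonDyer.Theorems.ErratumRoadFiveKolyvaginKernelHLFive
import Summits.BirchSwinnertonDyer.Rank1Residual.X11b.BDPRouteNoRam
import Summits.BirchSwinnertonDyer.Rank1Residual.X11b.Three.JetchevShapeOverK
import Summits.BirchSwinnertonDyer.Rank1Residual.X11b.Three.KolyvaginLine
import Summits.BirchSwinnertonDyer.Rank1Residual.X11b.KolyvaginBottomPoint
import Summits.BirchSwinnertonDyer.Rank1Residual.X11b.TwistTransportUnit
import Summits.BirchSwinnertonDyer.Rank1Residual.X11b.BDPRouteRankOneBookkeeping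
import Summits.BirchSwinnertonDyer.Rank1Residual.X2.TwistTamagawa
import Literature.NumberTheory.EllipticCurves.HeegnerPointsOfConductorOneData
import Literature.NumberTheory.EllipticCurves.HeegnerPointsOfConductorOneRationalityProofs
import Literature.NumberTheory.EllipticCurves.HeegnerPointsOfConductorOneGaloisConjProofs
import Literature.NumberTheory.EllipticCurves.KolyvaginShaStructureDivisibility
import Literature.NumberTheory.EllipticCurves.HeegnerPointsKolyvaginPrimaryGeneratorProofs
import Literature.NumberTheory.EllipticCurves.BSDSelmerCMPConverseHeegnerFieldProofs
import Literature.NumberTheory.EllipticCurves.BSDRootNumberSmallConductorProofs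
import Literature.NumberTheory.EllipticCurves.MordellWeilTheoremProofs
import Literature.NumberTheory.EllipticCurves.Wuthrich2014.ThreeAdicImageOrdinaryProofs
import HarnessLib

/-!
# PORT 3 ↦ p, layer 3 (crux `EulerHalfNotRamNoInertSetAtFive`, item stmt-BirchSwinnertonDyer-19715, deciding stub `stub_jetchevAtP`; RULING 52):
# McCallum's upper form ⟹ the Tamagawa-SHARPENED Kolyvagin bound over `K` at a general odd `p`, and TARGET (B) at a general odd `p`:
# the Euler-system half `Typed.MissingUpperBoundAt W p` on X11b ∧ surj ∧ MONO-CARRIER from the `JetchevMaxHL`-AT-`p` binder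

Cell `bsd-stepL`, seat `bsd-line-er5-p1-w2` (D-0154 width seat -w2; lead `bsd-line-er5-p1`), `--supports stmt-BirchSwinnertonDyer-19715`
(helper). THEOREMS ONLY; Theses-free imports (P3); namespace `…X11b.AtP.Koly`. The p = 3 originals (NOT edited; 1:1 file map, P3):
`Three.Koly.shaIndexBound_sharp_three_of_globalDivisibility` (`…ClassRecordThreeEulerHalvesAtThreeJetchev.lean` §1, tam3-p1) and TARGET (B)
`Three.Koly.missingUpperBoundAt_three_of_classX11b_of_surj_of_monoCarrier_of_jetchevMaxHL_of_twistLower`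
(`…ClassRecordThreeEulerHalvesAtThreeJetchevMax.lean` §2). PORT RULE (P2): `3 ↦ (p : ℕ) [Fact p.Prime]`, weakest side condition `p ≠ 2`;
the P1 certificate's only non-parametric step — `d_K ≠ −3` (there: `3` split in `K`) — is supplied here by the FIELD CHOICE
(`X11b.exists_oddHeegnerData_discr_lt`, er5 imc-p1: the Hoffstein–Luo field has `d_K < −4`); McCallum's tower-surjectivity binder by the generic
tower lemma `forall_hasSurjectiveModNGaloisRep_pow_of_multiplicative_of_surj` (Tate line at a multiplicative `p`, `p` odd); Darmon's conductor-1
datum and Shimura reciprocity at conductor 1 are the tree's `_holds` theorems. Everything else is the original text (audit by diff).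

* `shaIndexBound_sharp_atP_of_globalDivisibility` — AT ONE FRAME: `hMcU` (McCallum Cor. 5.6, upper form) turns global `p^s`-divisibility of all
  derived Heegner points (`s ≤ t`) on a conductor-1 frame into `ord_p #Ш(E/K) + 2t ≤ 2·ord_p [E(K):ℤP]`.
  -- adapted from Summits/BirchSwinnertonDyer/BirchSwinnertonDyer/Theorems/ClassRecordThreeEulerHalvesAtThreeJetchev.lean (§1)
* **`missingUpperBoundAt_atP_of_classX11b_of_surj_of_monoCarrier_of_jetchevMaxHL_of_twistLower`** — TARGET (B) AT `p`: for `ClassX11b W p`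
  (`r_an = 1`, `p` odd multiplicative, `E[p]` irreducible), `ρ̄_{E,p}` onto, ONE finite place `v` with `ord_p ∏_ℓ c_ℓ(E) ≤ ord_p c_v(E)`:
  `Typed.MissingUpperBoundAt W p` from the published facts (`hGZ hKo hGZK hmod hnf hHL hMaz hMcU`), the binder `hJmax` = `JetchevMaxHL` AT `p`
  (EXACTLY the conclusion shape of layer 2b's `jetchevMaxHLAtP_of_facts_of_print`, frame binder `d_K ≠ −3` included) and the rank-0 twist
  lower bound `hTL` at `p` (TLₚ).
  -- adapted from Summits/BirchSwinnertonDyer/BirchSwinnertonDyer/Theorems/ClassRecordThreeEulerHalvesAtThreeJetchevMax.lean (§2)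
* `missingUpperBoundAt_atP_of_classX11b_of_surj_of_not_ram_of_monoCarrier_of_jetchevMaxHL_of_lowerX11a` — the same on the ¬(ram) locus with
  TLₚ DISCHARGED by the X11a lower half at `p` (`hX11a`: every globally minimal `Wd` with `ClassX11a Wd p` has `Typed.MissingLowerBoundAt Wd p` —
  the shape of route item `X11aLowerHalf`, stmt-19064), since the Heegner twist `E^{d_K}` of a ¬(ram) X11b curve is an X11a pair
  (`X11b.classX11a_twist_of_not_ram`).

HONEST FRAMING: CONDITIONAL on every displayed binder (named facts as hypotheses; `hJmax` is NOT in print at `p ∣ N` as a statement — layer 2b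
derives it from six printed facts; `hTL`/`hX11a` are OPEN inputs); NO schema, NO `sorry`, NO new definition or named fact; nothing booked; no census
label moves (T7); `stub_jetchevAtP` is NOT closed by this file; BSD is proved for no curve by this seat.
[cite: McCallumLMS1991, §5 Cor. 5.6 (p. 310) and Lemma 5.1 (p. 303)] [cite: Jetchev2008, Thm. 1.4 and Cor. 1.5 (p. 812)]
[cite: Darmon2004, Thm. 3.6 (PDF p. 43)] [cite: HoffsteinLuo1997, Theorem (§1)] [cite: Miller2011LMS, Def. 1.1]
-/

set_option autoImplicit false

noncomputable section

open scoped Classical NumberField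

namespace Summit.BirchSwinnertonDyer.Rank1Residual.X11b.AtP.Koly

open WeierstrassCurve IsDedekindDomain Literature.NumberTheory.EllipticCurves
  Literature.NumberTheory.EllipticCurves.ModularForms
  Literature.NumberTheory.EllipticCurves.Rank1Residual
  Summit.BirchSwinnertonDyer.Rank1Residual Summit.BirchSwinnertonDyer.Rank1Residual.X11b
  Summit.BirchSwinnertonDyer.Rank1Residual.X11b.Three.Koly

/-! ### §1 At one frame: global divisibility + McCallum's upper form ⇒ the sharpened bound over `K` (general odd `p`) -/

/-- **The Tamagawa-sharpened Kolyvagin bound over `K` from global divisibility (one frame, general odd `p`).** For `W/ℚ` globally minimal,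
multiplicative at the odd prime `p` with `ρ̄_{E,p}` onto (so `ρ_{E,p^m}` onto for all `m`, Tate line; non-CM), `K` imaginary quadratic Heegner
for `N_E` with `d_K ∉ {−3, −4}`, a conductor-`1` Kolyvagin–Heegner datum `d₁` on the frame `(Dt, β, ι)` whose derived point is `P ∈ E(K)`,
`P` of infinite order, `E(K)` of rank one without `p`-torsion, `Ш(E/K)` finite: IF every derived point `P_n` on the frame with `n` a square-free
product of Kolyvagin primes of index `≥ s` is `p^s`-divisible for all `s ≤ t` (`hglob`) and McCallum's Cor. 5.6 upper form holds (`hMcU`), THEN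
`ord_p #Ш(E/K) + 2t ≤ 2·ord_p [E(K):ℤP]`. Port of `Three.Koly.shaIndexBound_sharp_three_of_globalDivisibility` (`3 ↦ p`, `p ≠ 2`).
CONDITIONAL on `hMcU` and `hglob`.
[cite: McCallumLMS1991, §5 Cor. 5.6 (p. 310) and Lemma 5.1 (p. 303)] [cite: Jetchev2008, §1 (1) and Conj. 1.3 (p. 812)] -/
theorem shaIndexBound_sharp_atP_of_globalDivisibility (p : ℕ) [Fact p.Prime] (hp2 : p ≠ 2)
    (hMcU : McCallum1991_padicValNat_card_sha_primary_add_le_of_globalDivisibility)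
    (W : WeierstrassCurve ℚ) [W.IsElliptic] [W.IsGloballyMinimal] [NeZero (W.conductorNorm ℤ)]
    (K : Type) [Field K] [NumberField K]
    (hmult : W.HasMultiplicativeReductionAtPrime p) (hρ : Surj W p)
    (hK : IsImaginaryQuadratic K) (h3 : NumberField.discr K ≠ -3) (h4 : NumberField.discr K ≠ -4)
    (hHN : SatisfiesHeegnerHypothesis (W.conductorNorm ℤ) K)
    (Dt : ModularParametrizationData W (W.conductorNorm ℤ)) (β : ℤ) (ι : K →+* ℂ)
    (d₁ : KolyvaginHeegnerData Dt β ι 1) (P : (W.baseChange K).toAffine.Point)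
    (hPd : d₁.toGeomPoints d₁.derivedPoint = toGeomPoints (W.baseChange K) P)
    (hPinf : ¬ IsOfFinAddOrder P)
    (hrank : (W.baseChange K).mordellWeilRank = 1)
    (hiv : ∀ x : (W.baseChange K).toAffine.Point, p • x = 0 → x = 0)
    [Finite (W.baseChange K).sha] {t : ℕ}
    (hglob : ∀ (s : ℕ), s ≤ t → ∀ (n : ℕ) (d : KolyvaginHeegnerData Dt β ι n), Squarefree n →
      (∀ ℓ ∈ n.primeFactors, Zhang2014.IsKolyvaginPrime (W.conductorNorm ℤ) W K p ℓ ∧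
        s ≤ Zhang2014.kolyvaginIndex W p ℓ) → PDiv d p s) :
    padicValNat p (Nat.card (W.baseChange K).sha) + 2 * t ≤
      2 * padicValNat p (AddSubgroup.zmultiples P).index := by
  -- adapted from Summits/BirchSwinnertonDyer/BirchSwinnertonDyer/Theorems/ClassRecordThreeEulerHalvesAtThreeJetchev.lean
  have hp : p.Prime := Fact.out
  -- tower surjectivity at a multiplicative odd p (Tate line) and no CM
  have hsurj : ∀ m : ℕ, W.HasSurjectiveModNGaloisRep (p ^ m : ℕ) :=
    forall_hasSurjectiveModNGaloisRep_pow_of_multiplicative_of_surj W p hp2 hmult hρ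
  have hCM : ¬ W.HasCM := not_hasCM_of_hasMultiplicativeReductionAtPrime' W hmult
  -- the exponent p^{M₀} ∥ P (Mordell–Weil)
  haveI : Module.Finite ℤ (W.baseChange K).toAffine.Point := (W.baseChange K).module_finite_point_holds
  obtain ⟨M₀, x₀, hx₀, hmax⟩ := exists_pow_smul_eq_and_forall_ne hPinf (p := p) hp.two_le
  have hdiv : ∃ Q : (W.baseChange K).toAffine.Point, ((p ^ M₀ : ℕ) : ℤ) • Q = P :=
    ⟨x₀, by rw [natCast_zsmul]; exact hx₀⟩
  have hndiv : ¬ ∃ Q : (W.baseChange K).toAffine.Point, ((p ^ (M₀ + 1) : ℕ) : ℤ) • Q = P := by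
    rintro ⟨Q, hQ⟩
    exact hmax Q (by rw [← natCast_zsmul]; exact hQ)
  -- McCallum's Cor. 5.6, upper form
  have hle : padicValNat p (Nat.card (AddCommGroup.primaryComponent (W.baseChange K).sha p)) + 2 * t ≤
      2 * M₀ :=
    hMcU W hCM K hK h3 h4 hHN p hp2 hsurj Dt β ι d₁ P hPd hPinf M₀ hdiv hndiv t
      (fun s hs n d hn hℓ ↦ hglob s hs n d hn hℓ)
  -- `ord_p #Ш = ord_p #Ш[p^∞]` and `ord_p [E(K):ℤP] = M₀`
  have hsha : padicValNat p (Nat.card (AddCommGroup.primaryComponent (W.baseChange K).sha p)) =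
      padicValNat p (Nat.card (W.baseChange K).sha) :=
    padicValNat_card_addPrimaryComponent (A := (W.baseChange K).sha) p
  haveI : Finite (AddCommGroup.torsion (W.baseChange K).toAffine.Point) :=
    WeierstrassCurve.finite_torsion_point (W := W.baseChange K)
  obtain ⟨c, Q, hcQ, hcker⟩ := RankOne.exists_coord_of_mordellWeilRank_eq_one (W.baseChange K) hrank
  have hidx : padicValNat p (AddSubgroup.zmultiples P).index = M₀ :=
    padicValNat_index_zmultiples_eq_of_divisibility c Q hcQ hcker hiv P hdiv hndiv
  rw [hidx, ← hsha]
  exact hle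

/-! ### §2 TARGET (B) at a general odd `p`: X11b ∧ surj ∧ MONO-CARRIER from `JetchevMaxHL` AT `p` + TLₚ -/

/-- **X11b@p ∧ surj ∧ MONO-CARRIER: the Euler-system half from `JetchevMaxHL` AT `p` + TLₚ** (+ the published facts), with NO (ram) hypothesis.
For `ClassX11b W p` (`p` odd), `ρ̄_{E,p}` onto and ONE finite place `v` with `ord_p ∏_ℓ c_ℓ(E) ≤ ord_p c_v(E)`: `Typed.MissingUpperBoundAt W p`.
Proof (the original's, `3 ↦ p`): one odd Hoffstein–Luo Heegner datum with a Manin-good frame and `d_K < −4` (`X11b.exists_oddHeegnerData_discr_lt`;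
Mazur; `w_K = 2`), a conductor-`1` Kolyvagin–Heegner datum on it (Darmon Thm. 3.6 and Shimura reciprocity at conductor 1 — tree `_holds`
theorems), the `hJmax` binder applied at the carrier `v` to depth `ord_p ∏c`, §1 (`hMcU`), and the descent to `ℚ`
(`missingUpperBoundAt_of_shaIndexBound_sharp`) with TLₚ for the twist `E^{d_K}` (no (ram) asked). Binders: published `hGZ hKo hGZK hmod hnf hHL
hMaz hMcU`; OPEN `hJmax` (Jetchev 2008 Thm. 1.4 «m_∞ ≥ max_q ord_p c_q» READ at `p ∥ N` — NOT in print at `p ∣ N`; = the conclusion of layer 2b's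
`jetchevMaxHLAtP_of_facts_of_print` from six printed facts) and `hTL` (the rank-0 `p`-part lower bound for a multiplicative `p`, `E[p]`
irreducible, without (ram)). CONDITIONAL; nothing booked.
[cite: Jetchev2008, Thm. 1.4 and Cor. 1.5 (p. 812)] [cite: McCallumLMS1991, §5 Cor. 5.6 (p. 310)] [cite: Darmon2004, Thm. 3.6 (PDF p. 43)]
[cite: HoffsteinLuo1997, Theorem (§1)] [cite: Miller2011LMS, Def. 1.1] -/
theorem missingUpperBoundAt_atP_of_classX11b_of_surj_of_monoCarrier_of_jetchevMaxHL_of_twistLower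
    (p : ℕ) [Fact p.Prime]
    -- published named facts
    (hGZ : ∀ (N : ℕ) [NeZero N] (W : WeierstrassCurve ℚ) (K : Type) [Field K] [NumberField K],
      gross_zagier N W K)
    (hKo : ∀ (N : ℕ) [NeZero N] (W : WeierstrassCurve ℚ) (K : Type) [Field K] [NumberField K],
      kolyvagin N W K)
    (hGZK : rank_eq_analyticRank_of_analyticRank_le_one) (hmod : hasEntireLFunction_rat)
    (hnf : exists_isNewformOf) (hHL : HoffsteinLuo1997_exists_twist_L_one_ne_zero)
    (hMaz : mazur_not_dvd_maninConstant_of_odd)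
    (hMcU : McCallum1991_padicValNat_card_sha_primary_add_le_of_globalDivisibility)
    -- OPEN INPUT `JetchevMaxHL` AT p (the conclusion shape of layer 2b's `jetchevMaxHLAtP_of_facts_of_print`)
    (hJmax : ∀ (W : WeierstrassCurve ℚ) [W.IsElliptic] [W.IsGloballyMinimal] [NeZero (W.conductorNorm ℤ)]
      (K : Type) [Field K] [NumberField K]
      (Dt : ModularParametrizationData W (W.conductorNorm ℤ)) (β : ℤ) (ι : K →+* ℂ),
      W.analyticRank = 1 → W.HasMultiplicativeReductionAtPrime p → Surj W p →
      IsImaginaryQuadratic K → SatisfiesHeegnerHypothesis (W.conductorNorm ℤ) K →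
      Odd (NumberField.discr K) → NumberField.discr K ≠ -3 →
      (W.quadraticTwist (NumberField.discr K : ℚ)).entireLFunction 1 ≠ 0 →
      (4 * (W.conductorNorm ℤ : ℤ)) ∣ β ^ 2 - NumberField.discr K → ¬ (p : ℤ) ∣ Dt.c →
      ∀ (v : HeightOneSpectrum (𝓞 ℚ)) (s : ℕ), s ≤ padicValNat p (W.tamagawaNumberAt v) →
        ∀ (n : ℕ) (d : KolyvaginHeegnerData Dt β ι n), Squarefree n →
          (∀ ℓ ∈ n.primeFactors, Zhang2014.IsKolyvaginPrime (W.conductorNorm ℤ) W K p ℓ ∧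
            s ≤ Zhang2014.kolyvaginIndex W p ℓ) → PDiv d p s)
    -- OPEN INPUT TLₚ: the rank-0 p-part lower bound at a multiplicative p, E[p] irreducible, NO (ram)
    (hTL : ∀ (V : WeierstrassCurve ℚ) [V.IsElliptic] [V.IsGloballyMinimal],
      V.HasMultiplicativeReductionAtPrime p → V.HasIrreducibleModPGaloisRep p →
      V.entireLFunction 1 ≠ 0 → Finite V.sha →
      ∃ q : ℚ, V.entireLFunction 1 / (V.realPeriodRat : ℂ) = (q : ℂ) ∧
        padicValRat p q ≤ (padicValNat p V.shaOrder : ℤ) + padicValNat p V.tamagawaProduct -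
          2 * padicValNat p V.torsionOrder)
    (W : WeierstrassCurve ℚ) [W.IsElliptic] [W.IsGloballyMinimal]
    (hX : ClassX11b W p) (hρ : Surj W p)
    (hmono : ∃ v : HeightOneSpectrum (𝓞 ℚ),
      padicValNat p W.tamagawaProduct ≤ padicValNat p (W.tamagawaNumberAt v)) :
    Typed.MissingUpperBoundAt W p := by
  -- adapted from Summits/BirchSwinnertonDyer/BirchSwinnertonDyer/Theorems/ClassRecordThreeEulerHalvesAtThreeJetchevMax.lean
  have hp : p.Prime := Fact.out
  haveI : NeZero (W.conductorNorm ℤ) := ⟨(W.conductorNorm_pos_holds).ne'⟩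
  obtain ⟨hr, hp2, hmult, hirr⟩ := hX
  obtain ⟨v, hv⟩ := hmono
  -- ONE odd Heegner datum with a Manin-good frame and `d_K < -4` (Hoffstein–Luo field; Mazur; w_K = 2)
  obtain ⟨K, _, _, Dt, H, ι, P, Wd, _, _, Cd, hK, hodd, hlt, hpd, hHN, hP, hc, hμ, hLt, hWd⟩ :=
    exists_oddHeegnerData_discr_lt hnf hHL hMaz integral_neronScaling_of_isGloballyMinimal_holds W p hr hp2
      hmult hirr
  have h3 : NumberField.discr K ≠ -3 := by omega
  have h4 : NumberField.discr K ≠ -4 := by omega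
  -- a conductor-1 Kolyvagin–Heegner datum on the frame (Dt, H.β, ι), with bottom point y_K = P
  obtain ⟨d₁⟩ := exists_kolyvaginHeegnerData_one (phi_heegnerTau_mem_singularModuliField_holds _ W K) hK Dt
    H.β ι H.dvd_sq_sub
  have hPd : d₁.toGeomPoints d₁.derivedPoint = toGeomPoints (W.baseChange K) P :=
    KolyvaginBottom.toGeomPoints_derivedPoint_one_eq (heegnerPointOfConductor_one_galoisConj_holds _ W K) hK
      hHN hP d₁ rfl
  -- global divisibility to depth ord_p ∏c on this frame: the max binder at the carrier v
  have hJW : ∀ (s : ℕ), s ≤ padicValNat p W.tamagawaProduct →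
      ∀ (n : ℕ) (d : KolyvaginHeegnerData Dt H.β ι n), Squarefree n →
        (∀ ℓ ∈ n.primeFactors, Zhang2014.IsKolyvaginPrime (W.conductorNorm ℤ) W K p ℓ ∧
          s ≤ Zhang2014.kolyvaginIndex W p ℓ) → PDiv d p s :=
    fun s hs n d hn hℓ ↦ hJmax W K Dt H.β ι hr hmult hρ hK hHN hodd h3 hLt H.dvd_sq_sub hc v s
      (hs.trans hv) n d hn hℓ
  -- the sharpened bound over K at this datum, from the divisibility + McCallum (§1)
  have hU : Finite (W.baseChange K).sha → ¬ IsOfFinAddOrder P →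
      padicValNat p (Nat.card (W.baseChange K).sha) + 2 * padicValNat p W.tamagawaProduct ≤
        2 * padicValNat p (AddSubgroup.zmultiples P).index := by
    intro hfin hPinf
    haveI : Finite (W.baseChange K).sha := hfin
    obtain ⟨hrank, -⟩ := hKo (W.conductorNorm ℤ) W K hK hHN ⟨Dt, H, ι, hP⟩ hPinf
    have hbot := torsionBy_eq_bot_of_isImaginaryQuadratic_of_hasIrreducibleModPGaloisRep W K hK hp hirr
    have hiv : ∀ x : (W.baseChange K).toAffine.Point, p • x = 0 → x = 0 := fun x hx ↦ by
      have hmem : x ∈ AddSubgroup.torsionBy (W.baseChange K).toAffine.Point ((p : ℕ) : ℤ) := by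
        rw [mem_torsionBy_iff, natCast_zsmul]
        exact hx
      rw [hbot] at hmem
      exact hmem
    exact shaIndexBound_sharp_atP_of_globalDivisibility p hp2 hMcU W K hmult hρ hK h3 h4 hHN Dt H.β ι d₁
      P hPd hPinf hrank hiv hJW
  -- the twist: transports (no (ram) needed) and TLₚ at its minimal model
  have hD0 : (NumberField.discr K : ℚ) ≠ 0 := by exact_mod_cast NumberField.discr_ne_zero K
  haveI hEt : (W.quadraticTwist (NumberField.discr K : ℚ)).IsElliptic :=
    W.isElliptic_quadraticTwist hD0
  have hmultd : Wd.HasMultiplicativeReductionAtPrime p :=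
    hasMultiplicativeReductionAtPrime_twist_of_heegner' W p K hK hHN hmult Cd hWd
  have hirrd : Wd.HasIrreducibleModPGaloisRep p :=
    hasIrreducibleModPGaloisRep_twist_model W p K hK.1 hirr Cd hWd
  have htam : padicValNat p Wd.tamagawaProduct = padicValNat p W.tamagawaProduct :=
    X2.padicValNat_tamagawaProduct_twist_of_heegner_of_odd W p hp2 K hK hodd hpd hHN Cd hWd
  have hu : padicValRat p (Cd.u : ℚ) = 0 :=
    padicValRat_u_eq_zero_of_twist_minimal W p K hK hHN hmult Cd hWd
  have hLt' : (W.quadraticTwist (NumberField.discr K : ℚ)).entireLFunction = Wd.entireLFunction := by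
    rw [← hWd, entireLFunction_smul]
  have hLd1 : Wd.entireLFunction 1 ≠ 0 := by rw [← hLt']; exact hLt
  have hfinSd : Finite Wd.sha := (hGZK Wd (by
    rw [(Wd.analyticRank_eq_zero_iff_holds (hmod Wd)).2 hLd1]; omega)).2
  obtain ⟨qd, hqd, hvqd⟩ := hTL Wd hmultd hirrd hLd1 hfinSd
  -- descent to ℚ (x11b3's data-level arithmetic)
  exact missingUpperBoundAt_of_shaIndexBound_sharp W p (W.conductorNorm ℤ) K Dt H ι P (hGZ _ W K)
    (hKo _ W K) hGZK hmod hK hHN hP hp2 hc hμ hr hLt Wd Cd hWd hu htam le_rfl ⟨qd, hqd, hvqd⟩ hU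

/-! ### §3 The same on the ¬(ram) locus, TLₚ discharged by the X11a lower half at `p` (route item `X11aLowerHalf`'s shape) -/

/-- **X11b@p ∧ surj ∧ ¬(ram) ∧ MONO-CARRIER: the Euler-system half from `JetchevMaxHL` AT `p` + the X11a LOWER HALF at `p`.** As §2, with the
twist input TLₚ replaced by `hX11a` («every globally minimal `Wd` with `ClassX11a Wd p` has `Typed.MissingLowerBoundAt Wd p`» — the shape of route
item `X11aLowerHalf`, stmt-19064, read at this `p`): the odd Heegner twist `Wd = Cd • E^{d_K}` of a ¬(ram) X11b curve is an X11a pair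
(`X11b.classX11a_twist_of_not_ram`: rank 0 by `L(E^{d_K},1) ≠ 0`, `p` multiplicative, `E^{d_K}[p]` irreducible, ¬(ram) inherited), and
`Typed.MissingLowerBoundAt Wd p` is put in the print shape `L(Wd,1)/Ω = q`, `ord_p q ≤ ord_p #Ш + ord_p ∏c − 2·ord_p #tors` by
`AdditivePotMult.exists_printShape_lower_of_missingLowerBoundAt_rankZero`. CONDITIONAL on `hJmax` (NOT in print at `p ∣ N`) and `hX11a` (OPEN);
nothing booked. [cite: Jetchev2008, Thm. 1.4 and Cor. 1.5 (p. 812)] [cite: McCallumLMS1991, §5 Cor. 5.6 (p. 310)] [cite: Miller2011LMS, Def. 1.1] -/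
theorem missingUpperBoundAt_atP_of_classX11b_of_surj_of_not_ram_of_monoCarrier_of_jetchevMaxHL_of_lowerX11a
    (p : ℕ) [Fact p.Prime]
    (hGZ : ∀ (N : ℕ) [NeZero N] (W : WeierstrassCurve ℚ) (K : Type) [Field K] [NumberField K],
      gross_zagier N W K)
    (hKo : ∀ (N : ℕ) [NeZero N] (W : WeierstrassCurve ℚ) (K : Type) [Field K] [NumberField K],
      kolyvagin N W K)
    (hGZK : rank_eq_analyticRank_of_analyticRank_le_one) (hmod : hasEntireLFunction_rat)
    (hnf : exists_isNewformOf) (hHL : HoffsteinLuo1997_exists_twist_L_one_ne_zero)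
    (hMaz : mazur_not_dvd_maninConstant_of_odd)
    (hMcU : McCallum1991_padicValNat_card_sha_primary_add_le_of_globalDivisibility)
    (hJmax : ∀ (W : WeierstrassCurve ℚ) [W.IsElliptic] [W.IsGloballyMinimal] [NeZero (W.conductorNorm ℤ)]
      (K : Type) [Field K] [NumberField K]
      (Dt : ModularParametrizationData W (W.conductorNorm ℤ)) (β : ℤ) (ι : K →+* ℂ),
      W.analyticRank = 1 → W.HasMultiplicativeReductionAtPrime p → Surj W p →
      IsImaginaryQuadratic K → SatisfiesHeegnerHypothesis (W.conductorNorm ℤ) K →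
      Odd (NumberField.discr K) → NumberField.discr K ≠ -3 →
      (W.quadraticTwist (NumberField.discr K : ℚ)).entireLFunction 1 ≠ 0 →
      (4 * (W.conductorNorm ℤ : ℤ)) ∣ β ^ 2 - NumberField.discr K → ¬ (p : ℤ) ∣ Dt.c →
      ∀ (v : HeightOneSpectrum (𝓞 ℚ)) (s : ℕ), s ≤ padicValNat p (W.tamagawaNumberAt v) →
        ∀ (n : ℕ) (d : KolyvaginHeegnerData Dt β ι n), Squarefree n →
          (∀ ℓ ∈ n.primeFactors, Zhang2014.IsKolyvaginPrime (W.conductorNorm ℤ) W K p ℓ ∧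
            s ≤ Zhang2014.kolyvaginIndex W p ℓ) → PDiv d p s)
    -- OPEN INPUT: the X11a lower half at p (route item `X11aLowerHalf` read at this p)
    (hX11a : ∀ (Wd : WeierstrassCurve ℚ) [Wd.IsElliptic] [Wd.IsGloballyMinimal],
      ClassX11a Wd p → Typed.MissingLowerBoundAt Wd p)
    (W : WeierstrassCurve ℚ) [W.IsElliptic] [W.IsGloballyMinimal]
    (hX : ClassX11b W p) (hρ : Surj W p) (hnram : ¬ Ram W p)
    (hmono : ∃ v : HeightOneSpectrum (𝓞 ℚ),
      padicValNat p W.tamagawaProduct ≤ padicValNat p (W.tamagawaNumberAt v)) :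
    Typed.MissingUpperBoundAt W p := by
  have hp : p.Prime := Fact.out
  haveI : NeZero (W.conductorNorm ℤ) := ⟨(W.conductorNorm_pos_holds).ne'⟩
  obtain ⟨hr, hp2, hmult, hirr⟩ := hX
  obtain ⟨v, hv⟩ := hmono
  -- ONE odd Heegner datum with a Manin-good frame and `d_K < -4` (Hoffstein–Luo field; Mazur; w_K = 2)
  obtain ⟨K, _, _, Dt, H, ι, P, Wd, _, _, Cd, hK, hodd, hlt, hpd, hHN, hP, hc, hμ, hLt, hWd⟩ :=
    exists_oddHeegnerData_discr_lt hnf hHL hMaz integral_neronScaling_of_isGloballyMinimal_holds W p hr hp2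
      hmult hirr
  have h3 : NumberField.discr K ≠ -3 := by omega
  have h4 : NumberField.discr K ≠ -4 := by omega
  -- a conductor-1 Kolyvagin–Heegner datum on the frame (Dt, H.β, ι), with bottom point y_K = P
  obtain ⟨d₁⟩ := exists_kolyvaginHeegnerData_one (phi_heegnerTau_mem_singularModuliField_holds _ W K) hK Dt
    H.β ι H.dvd_sq_sub
  have hPd : d₁.toGeomPoints d₁.derivedPoint = toGeomPoints (W.baseChange K) P :=
    KolyvaginBottom.toGeomPoints_derivedPoint_one_eq (heegnerPointOfConductor_one_galoisConj_holds _ W K) hK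
      hHN hP d₁ rfl
  -- global divisibility to depth ord_p ∏c on this frame: the max binder at the carrier v
  have hJW : ∀ (s : ℕ), s ≤ padicValNat p W.tamagawaProduct →
      ∀ (n : ℕ) (d : KolyvaginHeegnerData Dt H.β ι n), Squarefree n →
        (∀ ℓ ∈ n.primeFactors, Zhang2014.IsKolyvaginPrime (W.conductorNorm ℤ) W K p ℓ ∧
          s ≤ Zhang2014.kolyvaginIndex W p ℓ) → PDiv d p s :=
    fun s hs n d hn hℓ ↦ hJmax W K Dt H.β ι hr hmult hρ hK hHN hodd h3 hLt H.dvd_sq_sub hc v s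
      (hs.trans hv) n d hn hℓ
  -- the sharpened bound over K at this datum, from the divisibility + McCallum (§1)
  have hU : Finite (W.baseChange K).sha → ¬ IsOfFinAddOrder P →
      padicValNat p (Nat.card (W.baseChange K).sha) + 2 * padicValNat p W.tamagawaProduct ≤
        2 * padicValNat p (AddSubgroup.zmultiples P).index := by
    intro hfin hPinf
    haveI : Finite (W.baseChange K).sha := hfin
    obtain ⟨hrank, -⟩ := hKo (W.conductorNorm ℤ) W K hK hHN ⟨Dt, H, ι, hP⟩ hPinf
    have hbot := torsionBy_eq_bot_of_isImaginaryQuadratic_of_hasIrreducibleModPGaloisRep W K hK hp hirr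
    have hiv : ∀ x : (W.baseChange K).toAffine.Point, p • x = 0 → x = 0 := fun x hx ↦ by
      have hmem : x ∈ AddSubgroup.torsionBy (W.baseChange K).toAffine.Point ((p : ℕ) : ℤ) := by
        rw [mem_torsionBy_iff, natCast_zsmul]
        exact hx
      rw [hbot] at hmem
      exact hmem
    exact shaIndexBound_sharp_atP_of_globalDivisibility p hp2 hMcU W K hmult hρ hK h3 h4 hHN Dt H.β ι d₁
      P hPd hPinf hrank hiv hJW
  -- the twist is an X11a pair at p; its lower half in print shape
  have hD0 : (NumberField.discr K : ℚ) ≠ 0 := by exact_mod_cast NumberField.discr_ne_zero K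
  haveI hEt : (W.quadraticTwist (NumberField.discr K : ℚ)).IsElliptic :=
    W.isElliptic_quadraticTwist hD0
  have hirrd : Wd.HasIrreducibleModPGaloisRep p :=
    hasIrreducibleModPGaloisRep_twist_model W p K hK.1 hirr Cd hWd
  have htam : padicValNat p Wd.tamagawaProduct = padicValNat p W.tamagawaProduct :=
    X2.padicValNat_tamagawaProduct_twist_of_heegner_of_odd W p hp2 K hK hodd hpd hHN Cd hWd
  have hu : padicValRat p (Cd.u : ℚ) = 0 :=
    padicValRat_u_eq_zero_of_twist_minimal W p K hK hHN hmult Cd hWd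
  have hLt' : (W.quadraticTwist (NumberField.discr K : ℚ)).entireLFunction = Wd.entireLFunction := by
    rw [← hWd, entireLFunction_smul]
  have hLd1 : Wd.entireLFunction 1 ≠ 0 := by rw [← hLt']; exact hLt
  have hrd : Wd.analyticRank = 0 := (Wd.analyticRank_eq_zero_iff_holds (hmod Wd)).2 hLd1
  have hXa : ClassX11a Wd p := classX11a_twist_of_not_ram W p ⟨hr, hp2, hmult, hirr⟩ hnram K hK hHN Cd hWd hrd
  obtain ⟨qd, hqd, hvqd⟩ :=
    AdditivePotMult.exists_printShape_lower_of_missingLowerBoundAt_rankZero (p := p) Wd hGZK hrd hirrd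
      (hX11a Wd hXa)
  -- descent to ℚ (x11b3's data-level arithmetic)
  exact missingUpperBoundAt_of_shaIndexBound_sharp W p (W.conductorNorm ℤ) K Dt H ι P (hGZ _ W K)
    (hKo _ W K) hGZK hmod hK hHN hP hp2 hc hμ hr hLt Wd Cd hWd hu htam le_rfl ⟨qd, hqd, hvqd⟩ hU

end Summit.BirchSwinnertonDyer.Rank1Residual.X11b.AtP.Koly

end
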